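import Mathlib
import Literature.Probability.LatticeModels.LatticeGraph
import HarnessLib

/-!
# The precision operator is a Laplacian — abstract `ℓ¹` part, I: rows, mass bound, summability

Helper file for route `PrecisionLaplacian`, item `PrecisionIsLaplacian` (stmt-CriticalPhenomena-4803)
of `CriticalPhenomena/Ising3DConformalLimit` (continued in
`PrecisionLaplacianPrecisionIsLaplacianConvolution.lean`, which proves the convolution identity and
conservativity from the lemmas here).

We isolate the analytic half of the dictionary lemma from the matrix algebra. The data are a kernel
`G : ℤ³ → ℝ` (later: the critical two-point function `criticalTwoPoint 3`) and, for every finite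
`A ⊂ ℤ³`, the row `r A : ℤ³ → ℝ` of the origin in the inverse Gram matrix `(G_A)⁻¹`
(`r A y = (G_A)⁻¹(0,y)`, extended by `0`). The hypotheses are exactly what the symmetric-potential
property of the Gram matrices delivers (Z-signs `r A y ≤ 0` for `y ≠ 0`, row sum `≥ 0`, the row
identity `Σ_y r A y · G(z−y) = δ_{0z}`, Schur monotonicity `r A ≤ r A'` for `A ⊆ A'`, and a
uniform bound `r A 0 ≤ D`), together with `0 ≤ G ≤ G 0`, `G → 0` at infinity and `Σ G = ∞`.
With `m y := inf_{A ∋ 0,y} −r A y` we prove: `m ≥ 0` off `0`, `m 0 < 0`, `m` summable, the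
no-defect convolution identity `Σ_y m(y) G(z−y) = −δ_{z0}` (an `ε` / finite-set split using only
the uniform mass bound `Σ_{y≠0} −r A y ≤ r A 0 ≤ A₀` and `G → 0`), and conservativity `Σ_y m(y) = 0`:
if the killing rate `κ = A₀ − Σ_{y≠0} m(y)` were positive, summing the identity over a translate
`Λ + x` of a finite box and taking the supremum over `x` gives `κ · sup_x Σ_{Λ+x} G ≤ 1`, so `G`
would be summable — contradicting `χ(β_c) = ∞`. No Fourier analysis is used.
-/

namespace Summit.CriticalPhenomena.Ising3DConformalLimit.Theorems

open Filter Topology Finset Function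
open Literature.Probability.LatticeModels (Site)

section Abstract

variable {G : Site 3 → ℝ} {r : Finset (Site 3) → Site 3 → ℝ} {m mp : Site 3 → ℝ} {D : ℝ}

/-- `m y ≤ −r A y` whenever `0, y ∈ A` (the infimum is over a family bounded below by
`−max D 0`). -/
theorem pil_m_le
    (hrZ : ∀ A y, y ≠ 0 → r A y ≤ 0) (hrD : ∀ A, (0 : Site 3) ∈ A → r A 0 ≤ D)
    (hm : ∀ y, m y = ⨅ A : {A : Finset (Site 3) // (0 : Site 3) ∈ A ∧ y ∈ A}, -r A.1 y)
    {A : Finset (Site 3)} (h0 : (0 : Site 3) ∈ A) {y : Site 3} (hy : y ∈ A) :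
    m y ≤ -r A y := by
  rw [hm y]
  refine ciInf_le ⟨-(max D 0), ?_⟩
    (⟨A, h0, hy⟩ : {A : Finset (Site 3) // (0 : Site 3) ∈ A ∧ y ∈ A})
  rintro _ ⟨A', rfl⟩
  dsimp only
  by_cases hy0 : y = 0
  · subst hy0
    have h1 := hrD A'.1 A'.2.1
    have hD : D ≤ max D 0 := le_max_left _ _
    linarith
  · have h1 := hrZ A'.1 y hy0
    have h2 : (0 : ℝ) ≤ max D 0 := le_max_right _ _
    linarith

/-- `m y ≥ 0` for `y ≠ 0` (every `−r A y` is `≥ 0`). -/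
theorem pil_m_nonneg (hrZ : ∀ A y, y ≠ 0 → r A y ≤ 0)
    (hm : ∀ y, m y = ⨅ A : {A : Finset (Site 3) // (0 : Site 3) ∈ A ∧ y ∈ A}, -r A.1 y)
    {y : Site 3} (hy : y ≠ 0) : 0 ≤ m y := by
  rw [hm y]
  haveI : Nonempty {A : Finset (Site 3) // (0 : Site 3) ∈ A ∧ y ∈ A} :=
    ⟨⟨{0, y}, by simp, by simp⟩⟩
  exact le_ciInf fun A => by have := hrZ A.1 y hy; linarith

/-- The infimum defining `m y` is a monotone limit: for every `ε > 0` there is a finite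
`A₁ ∋ 0, y` such that `−r A' y < m y + ε` for all finite `A' ⊇ A₁`. -/
theorem pil_exists_lt
    (hrmono : ∀ A A', (0 : Site 3) ∈ A → A ⊆ A' → ∀ y ∈ A, r A y ≤ r A' y)
    (hm : ∀ y, m y = ⨅ A : {A : Finset (Site 3) // (0 : Site 3) ∈ A ∧ y ∈ A}, -r A.1 y)
    (y : Site 3) {ε : ℝ} (hε : 0 < ε) :
    ∃ A₁ : Finset (Site 3), (0 : Site 3) ∈ A₁ ∧ y ∈ A₁ ∧
      ∀ A', A₁ ⊆ A' → -r A' y < m y + ε := by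
  haveI : Nonempty {A : Finset (Site 3) // (0 : Site 3) ∈ A ∧ y ∈ A} :=
    ⟨⟨{0, y}, by simp, by simp⟩⟩
  have hlt : (⨅ A : {A : Finset (Site 3) // (0 : Site 3) ∈ A ∧ y ∈ A}, -r A.1 y) < m y + ε := by
    rw [← hm y]; linarith
  obtain ⟨A, hA⟩ := exists_lt_of_ciInf_lt hlt
  refine ⟨A.1, A.2.1, A.2.2, fun A' hAA' => ?_⟩
  have := hrmono A.1 A' A.2.1 hAA' y A.2.2
  linarith

/-- From the row identity at `z = 0`: `1 ≤ r A 0 · G 0` (the other summands are `≤ 0`). -/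
theorem pil_one_le_r_zero_mul (hG0 : ∀ x, 0 ≤ G x) (hrZ : ∀ A y, y ≠ 0 → r A y ≤ 0)
    (hrid : ∀ A, (0 : Site 3) ∈ A → ∀ z ∈ A,
      ∑ y ∈ A, r A y * G (z - y) = if z = 0 then 1 else 0)
    {A : Finset (Site 3)} (h0 : (0 : Site 3) ∈ A) : 1 ≤ r A 0 * G 0 := by
  have h := hrid A h0 0 h0
  rw [if_pos rfl, ← Finset.add_sum_erase A _ h0, sub_self] at h
  have hle : ∑ y ∈ A.erase 0, r A y * G (0 - y) ≤ 0 :=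
    Finset.sum_nonpos fun y hy =>
      mul_nonpos_of_nonpos_of_nonneg (hrZ A y (Finset.ne_of_mem_erase hy)) (hG0 _)
  linarith

/-- `G 0 > 0`. -/
theorem pil_G_zero_pos (hG0 : ∀ x, 0 ≤ G x) (hrZ : ∀ A y, y ≠ 0 → r A y ≤ 0)
    (hrid : ∀ A, (0 : Site 3) ∈ A → ∀ z ∈ A,
      ∑ y ∈ A, r A y * G (z - y) = if z = 0 then 1 else 0) : 0 < G 0 := by
  have h := pil_one_le_r_zero_mul hG0 hrZ hrid (Finset.mem_singleton_self (0 : Site 3))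
  rcases (hG0 0).lt_or_eq with h0 | h0
  · exact h0
  · rw [← h0, mul_zero] at h; linarith

/-- `r A 0 > 0` for `A ∋ 0` (diagonal of the inverse). -/
theorem pil_r_zero_pos (hG0 : ∀ x, 0 ≤ G x) (hrZ : ∀ A y, y ≠ 0 → r A y ≤ 0)
    (hrid : ∀ A, (0 : Site 3) ∈ A → ∀ z ∈ A,
      ∑ y ∈ A, r A y * G (z - y) = if z = 0 then 1 else 0)
    {A : Finset (Site 3)} (h0 : (0 : Site 3) ∈ A) : 0 < r A 0 := by
  have h := pil_one_le_r_zero_mul hG0 hrZ hrid h0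
  by_contra hneg
  have : r A 0 * G 0 ≤ 0 := mul_nonpos_of_nonpos_of_nonneg (le_of_not_gt hneg) (hG0 0)
  linarith

/-- `m 0 < 0`: indeed `m 0 ≤ −r {0} 0 < 0`. -/
theorem pil_m_zero_neg (hG0 : ∀ x, 0 ≤ G x) (hrZ : ∀ A y, y ≠ 0 → r A y ≤ 0)
    (hrid : ∀ A, (0 : Site 3) ∈ A → ∀ z ∈ A,
      ∑ y ∈ A, r A y * G (z - y) = if z = 0 then 1 else 0)
    (hrD : ∀ A, (0 : Site 3) ∈ A → r A 0 ≤ D)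
    (hm : ∀ y, m y = ⨅ A : {A : Finset (Site 3) // (0 : Site 3) ∈ A ∧ y ∈ A}, -r A.1 y) :
    m 0 < 0 := by
  have h1 := pil_m_le hrZ hrD hm (Finset.mem_singleton_self (0 : Site 3))
    (Finset.mem_singleton_self (0 : Site 3))
  have h2 := pil_r_zero_pos hG0 hrZ hrid (Finset.mem_singleton_self (0 : Site 3))
  linarith

/-- `mp ≥ 0`, where `mp` is `m` with the value at the origin replaced by `0`. -/
theorem pil_mp_nonneg (hrZ : ∀ A y, y ≠ 0 → r A y ≤ 0)
    (hm : ∀ y, m y = ⨅ A : {A : Finset (Site 3) // (0 : Site 3) ∈ A ∧ y ∈ A}, -r A.1 y)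
    (hmp : ∀ y, mp y = if y = 0 then 0 else m y) (y : Site 3) : 0 ≤ mp y := by
  rw [hmp y]
  split_ifs with hy0
  · exact le_rfl
  · exact pil_m_nonneg hrZ hm hy0

/-- `m` is `mp` updated at the origin. -/
theorem pil_m_eq_update (hmp : ∀ y, mp y = if y = 0 then 0 else m y) :
    m = Function.update mp 0 (m 0) := by
  funext y
  by_cases hy : y = 0
  · subst hy; simp
  · rw [Function.update_of_ne hy, hmp y, if_neg hy]

/-- A finite-volume bound behind summability and the convolution identity: for `0, z ∈ A` and
`u ⊆ A`, `Σ_{y ∈ u} mp y · G(z−y) ≤ r A 0 · G z − δ_{z0}`. -/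
theorem pil_sum_mp_mul_le (hG0 : ∀ x, 0 ≤ G x) (hrZ : ∀ A y, y ≠ 0 → r A y ≤ 0)
    (hrid : ∀ A, (0 : Site 3) ∈ A → ∀ z ∈ A,
      ∑ y ∈ A, r A y * G (z - y) = if z = 0 then 1 else 0)
    (hrD : ∀ A, (0 : Site 3) ∈ A → r A 0 ≤ D)
    (hm : ∀ y, m y = ⨅ A : {A : Finset (Site 3) // (0 : Site 3) ∈ A ∧ y ∈ A}, -r A.1 y)
    (hmp : ∀ y, mp y = if y = 0 then 0 else m y)
    {A u : Finset (Site 3)} (h0 : (0 : Site 3) ∈ A) {z : Site 3} (hz : z ∈ A) (huA : u ⊆ A) :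
    ∑ y ∈ u, mp y * G (z - y) ≤ r A 0 * G z - (if z = 0 then 1 else 0) := by
  have h1 : ∑ y ∈ u, mp y * G (z - y) ≤ ∑ y ∈ u, (if y = 0 then (0 : ℝ) else -r A y) * G (z - y) := by
    refine Finset.sum_le_sum fun y hy => mul_le_mul_of_nonneg_right ?_ (hG0 _)
    rw [hmp y]
    split_ifs with hy0
    · exact le_rfl
    · exact pil_m_le hrZ hrD hm h0 (huA hy)
  have h2 : ∑ y ∈ u, (if y = 0 then (0 : ℝ) else -r A y) * G (z - y)
      ≤ ∑ y ∈ A, (if y = 0 then (0 : ℝ) else -r A y) * G (z - y) := by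
    refine Finset.sum_le_sum_of_subset_of_nonneg huA fun y _ _ => mul_nonneg ?_ (hG0 _)
    split_ifs with hy0
    · exact le_rfl
    · have := hrZ A y hy0; linarith
  have h3 : ∑ y ∈ A, (if y = 0 then (0 : ℝ) else -r A y) * G (z - y)
      = r A 0 * G z - ∑ y ∈ A, r A y * G (z - y) := by
    rw [← Finset.add_sum_erase A _ h0, ← Finset.add_sum_erase A (fun y => r A y * G (z - y)) h0,
      if_pos rfl, zero_mul, zero_add, sub_zero,
      Finset.sum_congr rfl (fun y hy => by rw [if_neg (Finset.ne_of_mem_erase hy)])]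
    simp only [neg_mul, Finset.sum_neg_distrib]
    ring
  rw [hrid A h0 z hz] at h3
  linarith

/-- Partial sums of `mp` are bounded by `A₀ = −m 0`. -/
theorem pil_sum_mp_le (hrZ : ∀ A y, y ≠ 0 → r A y ≤ 0)
    (hrsum : ∀ A, (0 : Site 3) ∈ A → 0 ≤ ∑ y ∈ A, r A y)
    (hrD : ∀ A, (0 : Site 3) ∈ A → r A 0 ≤ D)
    (hm : ∀ y, m y = ⨅ A : {A : Finset (Site 3) // (0 : Site 3) ∈ A ∧ y ∈ A}, -r A.1 y)
    (hmp : ∀ y, mp y = if y = 0 then 0 else m y) (u : Finset (Site 3)) :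
    ∑ y ∈ u, mp y ≤ -m 0 := by
  set A := insert (0 : Site 3) u with hA
  have h0 : (0 : Site 3) ∈ A := Finset.mem_insert_self _ _
  have huA : u ⊆ A := Finset.subset_insert _ _
  have h1 : ∑ y ∈ u, mp y ≤ ∑ y ∈ u, (if y = 0 then (0 : ℝ) else -r A y) := by
    refine Finset.sum_le_sum fun y hy => ?_
    rw [hmp y]
    split_ifs with hy0
    · exact le_rfl
    · exact pil_m_le hrZ hrD hm h0 (huA hy)
  have h2 : ∑ y ∈ u, (if y = 0 then (0 : ℝ) else -r A y)
      ≤ ∑ y ∈ A, (if y = 0 then (0 : ℝ) else -r A y) := by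
    refine Finset.sum_le_sum_of_subset_of_nonneg huA fun y _ _ => ?_
    split_ifs with hy0
    · exact le_rfl
    · have := hrZ A y hy0; linarith
  have h3 : ∑ y ∈ A, (if y = 0 then (0 : ℝ) else -r A y) = r A 0 - ∑ y ∈ A, r A y := by
    rw [← Finset.add_sum_erase A _ h0, ← Finset.add_sum_erase A (fun y => r A y) h0,
      if_pos rfl, zero_add,
      Finset.sum_congr rfl (fun y hy => by rw [if_neg (Finset.ne_of_mem_erase hy)])]
    simp only [Finset.sum_neg_distrib]
    ring
  have h4 := hrsum A h0
  have h5 : r A 0 ≤ -m 0 := by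
    have := pil_m_le hrZ hrD hm h0 h0
    linarith
  linarith

/-- `mp` is summable (nonnegative with bounded partial sums). -/
theorem pil_summable_mp (hrZ : ∀ A y, y ≠ 0 → r A y ≤ 0)
    (hrsum : ∀ A, (0 : Site 3) ∈ A → 0 ≤ ∑ y ∈ A, r A y)
    (hrD : ∀ A, (0 : Site 3) ∈ A → r A 0 ≤ D)
    (hm : ∀ y, m y = ⨅ A : {A : Finset (Site 3) // (0 : Site 3) ∈ A ∧ y ∈ A}, -r A.1 y)
    (hmp : ∀ y, mp y = if y = 0 then 0 else m y) : Summable mp :=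
  summable_of_sum_le (fun y => pil_mp_nonneg hrZ hm hmp y)
    (fun u => pil_sum_mp_le hrZ hrsum hrD hm hmp u)

/-- `Σ' mp ≤ A₀ = −m 0` (the killing rate `κ = A₀ − Σ_{y≠0} m y` is nonnegative). -/
theorem pil_tsum_mp_le (hrZ : ∀ A y, y ≠ 0 → r A y ≤ 0)
    (hrsum : ∀ A, (0 : Site 3) ∈ A → 0 ≤ ∑ y ∈ A, r A y)
    (hrD : ∀ A, (0 : Site 3) ∈ A → r A 0 ≤ D)
    (hm : ∀ y, m y = ⨅ A : {A : Finset (Site 3) // (0 : Site 3) ∈ A ∧ y ∈ A}, -r A.1 y)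
    (hmp : ∀ y, mp y = if y = 0 then 0 else m y) : ∑' y, mp y ≤ -m 0 :=
  Real.tsum_le_of_sum_le (fun y => pil_mp_nonneg hrZ hm hmp y)
    (fun u => pil_sum_mp_le hrZ hrsum hrD hm hmp u)

/-- `m` is summable. -/
theorem pil_summable_m (hrZ : ∀ A y, y ≠ 0 → r A y ≤ 0)
    (hrsum : ∀ A, (0 : Site 3) ∈ A → 0 ≤ ∑ y ∈ A, r A y)
    (hrD : ∀ A, (0 : Site 3) ∈ A → r A 0 ≤ D)
    (hm : ∀ y, m y = ⨅ A : {A : Finset (Site 3) // (0 : Site 3) ∈ A ∧ y ∈ A}, -r A.1 y)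
    (hmp : ∀ y, mp y = if y = 0 then 0 else m y) : Summable m := by
  rw [pil_m_eq_update hmp]
  exact (pil_summable_mp hrZ hrsum hrD hm hmp).update 0 (m 0)

/-- `Σ' m = Σ' mp + m 0`. -/
theorem pil_tsum_m (hrZ : ∀ A y, y ≠ 0 → r A y ≤ 0)
    (hrsum : ∀ A, (0 : Site 3) ∈ A → 0 ≤ ∑ y ∈ A, r A y)
    (hrD : ∀ A, (0 : Site 3) ∈ A → r A 0 ≤ D)
    (hm : ∀ y, m y = ⨅ A : {A : Finset (Site 3) // (0 : Site 3) ∈ A ∧ y ∈ A}, -r A.1 y)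
    (hmp : ∀ y, mp y = if y = 0 then 0 else m y) : ∑' y, m y = (∑' y, mp y) + m 0 := by
  have hfun : m = Function.update mp 0 (m 0) := pil_m_eq_update hmp
  have h := (pil_summable_mp hrZ hrsum hrD hm hmp).hasSum.update 0 (m 0)
  rw [← hfun] at h
  rw [h.tsum_eq, hmp 0, if_pos rfl]
  ring

/-- Summability of `y ↦ mp y · G(z − y)` (`0 ≤ mp` summable, `0 ≤ G ≤ G 0`). -/
theorem pil_summable_mp_mul (hG0 : ∀ x, 0 ≤ G x) (hGb : ∀ x, G x ≤ G 0)
    (hrZ : ∀ A y, y ≠ 0 → r A y ≤ 0)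
    (hrsum : ∀ A, (0 : Site 3) ∈ A → 0 ≤ ∑ y ∈ A, r A y)
    (hrD : ∀ A, (0 : Site 3) ∈ A → r A 0 ≤ D)
    (hm : ∀ y, m y = ⨅ A : {A : Finset (Site 3) // (0 : Site 3) ∈ A ∧ y ∈ A}, -r A.1 y)
    (hmp : ∀ y, mp y = if y = 0 then 0 else m y) (z : Site 3) :
    Summable fun y => mp y * G (z - y) := by
  have hs := pil_summable_mp hrZ hrsum hrD hm hmp
  refine Summable.of_nonneg_of_le (fun y => mul_nonneg (pil_mp_nonneg hrZ hm hmp y) (hG0 _))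
    (fun y => mul_le_mul_of_nonneg_left (hGb _) (pil_mp_nonneg hrZ hm hmp y)) (hs.mul_right (G 0))

/-- Upper half of the convolution identity: `Σ'_y mp y · G(z−y) ≤ A₀ G z − δ_{z0}`. -/
theorem pil_tsum_mp_mul_le (hG0 : ∀ x, 0 ≤ G x) (hrZ : ∀ A y, y ≠ 0 → r A y ≤ 0)
    (hrid : ∀ A, (0 : Site 3) ∈ A → ∀ z ∈ A,
      ∑ y ∈ A, r A y * G (z - y) = if z = 0 then 1 else 0)
    (hrD : ∀ A, (0 : Site 3) ∈ A → r A 0 ≤ D)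
    (hm : ∀ y, m y = ⨅ A : {A : Finset (Site 3) // (0 : Site 3) ∈ A ∧ y ∈ A}, -r A.1 y)
    (hmp : ∀ y, mp y = if y = 0 then 0 else m y) (z : Site 3) :
    ∑' y, mp y * G (z - y) ≤ -m 0 * G z - (if z = 0 then 1 else 0) := by
  refine Real.tsum_le_of_sum_le (fun y => mul_nonneg (pil_mp_nonneg hrZ hm hmp y) (hG0 _))
    fun u => ?_
  set A := insert (0 : Site 3) (insert z u) with hA
  have h0 : (0 : Site 3) ∈ A := Finset.mem_insert_self _ _
  have hz : z ∈ A := Finset.mem_insert_of_mem (Finset.mem_insert_self _ _)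
  have huA : u ⊆ A := (Finset.subset_insert _ _).trans (Finset.subset_insert _ _)
  have h := pil_sum_mp_mul_le hG0 hrZ hrid hrD hm hmp h0 hz huA
  have h5 : r A 0 ≤ -m 0 := by
    have := pil_m_le hrZ hrD hm h0 h0
    linarith
  have h6 : r A 0 * G z ≤ -m 0 * G z := mul_le_mul_of_nonneg_right h5 (hG0 z)
  linarith

end Abstract

end Summit.CriticalPhenomena.Ising3DConformalLimit.Theorems
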